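import Summits.NavierStokesRegularity.NavierStokesRegularity.Theorems.ScenarioCensusRowF1RateTableKill
import Summits.NavierStokesRegularity.NavierStokesRegularity.Theorems.ScenarioCensusRowF1SocketReadout
import HarnessLib

/-!
# LINE 26 «rate-table» port, part 4/5: §9 THE TWO NEW CELLS — the numbers `matIntegrand` / `idlIntegrand`, the rows `Row_F1im` / `Row_F1id`, the floors `DivergentMaterialExcess` /
# `DivergentIdealExcess`, the residual `TableSlack` (≡ `Row_F1`), the dictionary, both rows EXCLUDED (`rowF1im_holds`, `rowF1id_holds`), the floors, ancient displays

Re-homed for the scenario census (typer seat ns-census-typer-1 g9; the cells F1im / F1id and the floors DM / DI are MEMBERS OF RECORD «DECIDED IN KERNEL IN FILES» of row F1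
since census v1.78 (critic idea-crit-3 PASS; ref ns-census-ref g10 PRE-CHECK ✓ §15.23 item 45; lead-presearch label); this port makes them TREE-decided): VERBATIM PORT
of the NEW declarations (§1 material / ideal read-outs, §7 maximum principles, §9 rows) of ns-idea-3 LINE 26 «rate-table»,
`pub/ideators/ns-idea-3/lines/rate-table/line-rate-table.lean` sha16 99519954933d87d3 (2726 l., lean check rc 0, 0 sorry; the frame of §1, the Eulerian read-outs, §2–§6 and §8
are shared VERBATIM with LINES 18/20/22/24/25/27 and taken BY NAME from the landed ports — not re-declared), split for the 400-line rule into `ScenarioCensusRowF1RateTable`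
(§1) → `…RateTableMaxPrinciple` (§7a) → `…RateTableKill` (§7b) → `…RateTableRows` (§9 rows/verdicts) → `…RateTableTop` (§9 corollaries + census KEYS).  Lean text VERBATIM
in namespace `…Theorems.ScenarioCensus.RateTable` (the line's `…Cruxes.ScenarioCensusRowF1.RateTableLine` re-homed), shared names spelled by namespace (`EulerianPincer.…`,
`LiouvilleSocket.…`, `FrozenTop.…`, `InviscidTop.…`, …); port edits: the bracket lines `section …` / `end …` dropped (no `variable`s), `@[conjecture]` on the residual
`TableSlack` (≡ `ScenarioCensus.Row_F1`, OPEN), one-line docstrings added where missing (gate lint), two `have` statements spell the τ-tool's `lapD` (defeq; proof text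
only).  Statements untouched.

No census VALUE is moved here (row F1 stays OPEN-WITH-LINE; the members become TREE-decided by name); NS regularity is NOT proved; `Row_F1` is untouched (zero
movement, `tableSlack_iff_rowF1`); no summit statement is proved by this file. Lemmas that restate already-landed tree declarations are taken BY NAME (gate lint `dedup.landed`): `materialNonIncreasing_ancient_trivial` = `IntegratedQuench.eq_zero_of_nonIntensifying`.
-/

-- the summit and its single problem share the name `NavierStokesRegularity` (D-0017 nested layout)
set_option linter.dupNamespace false

noncomputable section

open MeasureTheory Set Function Filter TopologicalSpace Metric
open scoped Topology NNReal ENNReal InnerProductSpace RealInnerProductSpace Laplacian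

namespace Summit.NavierStokesRegularity.NavierStokesRegularity.Theorems.ScenarioCensus.RateTable

open Literature.Analysis Literature.Analysis.FluidPDE
open Summit.NavierStokesRegularity.NavierStokesRegularity.Theorems

/-! ## §9 THE TWO NEW CELLS OF THE RATE TABLE (NEW): the numbers, the rows `F1im` (material allowance) and `F1id`
(ideal allowance), both EXCLUDED; their floors; the residual ≡ `Row_F1`; sign rows, eventual threshold rows and the
unification with LINE 22's parameter-free row `F1iq` (re-proved here by the maximum principle) as corollaries in kernel -/

/-- The number of the material cell — the **MATERIAL ALLOWANCE-EXCESS INTEGRAND OF THE FAST FLUID** on `[t₀, T)`: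
`𝟙{t ∈ [t₀,T), Λ(t) < |u(t,x)|} · √(T − t) · max(0, ⟪ω, ∂ₜω + (u·∇)ω⟫ − θ |ω|²/(T − t))`, `ω = curl u`
(`⟪ω, ∂ₜω + (u·∇)ω⟫ = ½ Dₜ|ω|²`: HALF THE MATERIAL RATE of the enstrophy density, charged only in EXCESS of the
fraction `θ` of the self-similar rate; pressure-free and viscosity-free; `∂ₜ` within `[0, T)`, `vorticity u t = curl (u t)`;
at `θ = 0`, `t₀ = 0` this is LINE 22's intensification integrand). -/
def matIntegrand (T θ t₀ : ℝ) (Λ : ℝ → ℝ) (u : ℝ → LiouvilleSocket.E3 → LiouvilleSocket.E3) : ℝ × LiouvilleSocket.E3 → ℝ≥0∞ :=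
  {z : ℝ × LiouvilleSocket.E3 | z.1 ∈ Ico t₀ T ∧ Λ z.1 < ‖u z.1 z.2‖}.indicator fun z =>
    ENNReal.ofReal (Real.sqrt (T - z.1) *
      max 0 (⟪curl (u z.1) z.2,
          timeDerivWithin (Ico 0 T) (vorticity u) z.1 z.2 + convect (u z.1) (curl (u z.1)) z.2⟫
        - θ * ((T - z.1)⁻¹ * ‖curl (u z.1) z.2‖ ^ 2)))

/-- The number of the ideal cell — the **IDEAL ALLOWANCE-EXCESS INTEGRAND OF THE FAST FLUID** on `[t₀, T)`:
`𝟙{t ∈ [t₀,T), Λ(t) < |u(t,x)|} · √(T − t) · max(0, ⟪ω, (ω·∇)u − (u·∇)ω⟫ − θ |ω|²/(T − t))` — KINEMATIC (first and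
second derivatives of ONE velocity snapshot; no `∂ₜ`, no `ν`, no pressure): stretching net of the advective flux of
enstrophy, `= ½ ∂ₜ|ω|² − ν⟪ω, Δω⟫` for the solution. -/
def idlIntegrand (T θ t₀ : ℝ) (Λ : ℝ → ℝ) (u : ℝ → LiouvilleSocket.E3 → LiouvilleSocket.E3) : ℝ × LiouvilleSocket.E3 → ℝ≥0∞ :=
  {z : ℝ × LiouvilleSocket.E3 | z.1 ∈ Ico t₀ T ∧ Λ z.1 < ‖u z.1 z.2‖}.indicator fun z =>
    ENNReal.ofReal (Real.sqrt (T - z.1) *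
      max 0 (⟪curl (u z.1) z.2, convect (curl (u z.1)) (u z.1) z.2 - convect (u z.1) (curl (u z.1)) z.2⟫
        - θ * ((T - z.1)⁻¹ * ‖curl (u z.1) z.2‖ ^ 2)))

/-- **Criterion row F1im** (the exact frame of `Row_F1` plus ONE hypothesis: for some `θ < 1`, some `t₀ ∈ [0, T)` and
some MEASURABLE subcritical level, the material allowance-excess of the fast fluid is integrable against `√(T − t)` on
`[t₀, T) × ℝ³`).  PROVED (`rowF1im_holds`).  At `θ = 0`, `t₀ = 0` it is LINE 22's row `F1iq` (`rowF1iq_of_rowF1im`). -/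
def Row_F1im : Prop :=
  ∀ (ν T : ℝ), 0 < ν → 0 < T → ∀ (u : ℝ → LiouvilleSocket.E3 → LiouvilleSocket.E3) (p : ℝ → LiouvilleSocket.E3 → ℝ),
    IsClassicalNSSolutionOn (Ico 0 T) ν 0 u p → IsLerayHopfOn T ν 0 (u 0) u →
    HasRapidSpatialDecay (u 0) → IsTypeIBlowup u T →
    (∃ (θ t₀ : ℝ) (Λ : ℝ → ℝ), θ < 1 ∧ 0 ≤ t₀ ∧ t₀ < T ∧ LiouvilleSocket.IsSubcriticalLevel T Λ ∧ Measurable Λ ∧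
      ∫⁻ z, matIntegrand T θ t₀ Λ u z < ⊤) →
    HasSmoothExtensionPast ν 0 u T

/-- **Criterion row F1id** (the frame of `Row_F1` plus: for some `θ < 1`, `t₀ ∈ [0, T)` and some measurable subcritical
level, the ideal allowance-excess of the fast fluid is integrable against `√(T − t)` on `[t₀, T) × ℝ³`).  PROVED
(`rowF1id_holds`). -/
def Row_F1id : Prop :=
  ∀ (ν T : ℝ), 0 < ν → 0 < T → ∀ (u : ℝ → LiouvilleSocket.E3 → LiouvilleSocket.E3) (p : ℝ → LiouvilleSocket.E3 → ℝ),
    IsClassicalNSSolutionOn (Ico 0 T) ν 0 u p → IsLerayHopfOn T ν 0 (u 0) u →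
    HasRapidSpatialDecay (u 0) → IsTypeIBlowup u T →
    (∃ (θ t₀ : ℝ) (Λ : ℝ → ℝ), θ < 1 ∧ 0 ≤ t₀ ∧ t₀ < T ∧ LiouvilleSocket.IsSubcriticalLevel T Λ ∧ Measurable Λ ∧
      ∫⁻ z, idlIntegrand T θ t₀ Λ u z < ⊤) →
    HasSmoothExtensionPast ν 0 u T

/-- **DIVERGENT MATERIAL EXCESS** (structural floor, maximal frame): for a maximal Type-I Clay blow-up, EVERY `θ < 1`,
every `t₀ ∈ [0, T)` and every measurable subcritical level,
`∬_{[t₀,T), |u| > Λ(t)} √(T − t) [½Dₜ|ω|² − θ|ω|²/(T − t)]₊ dx dt = ∞`.  PROVED (`divergentMaterialExcess_holds`). -/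
def DivergentMaterialExcess : Prop :=
  ∀ (ν T : ℝ), 0 < ν → 0 < T → ∀ (u : ℝ → LiouvilleSocket.E3 → LiouvilleSocket.E3) (p : ℝ → LiouvilleSocket.E3 → ℝ),
    IsMaximalSmoothSolution ν 0 u p T → IsLerayHopfOn T ν 0 (u 0) u →
    HasRapidSpatialDecay (u 0) → IsTypeIBlowup u T →
    ∀ θ : ℝ, θ < 1 → ∀ t₀ : ℝ, 0 ≤ t₀ → t₀ < T →
    ∀ Λ : ℝ → ℝ, LiouvilleSocket.IsSubcriticalLevel T Λ → Measurable Λ → ∫⁻ z, matIntegrand T θ t₀ Λ u z = ⊤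

/-- **DIVERGENT IDEAL EXCESS** (structural floor, maximal frame): for a maximal Type-I Clay blow-up, EVERY `θ < 1`,
every `t₀ ∈ [0, T)` and every measurable subcritical level,
`∬_{[t₀,T), |u| > Λ(t)} √(T − t) [⟪ω, Sω⟫ − ½(u·∇)|ω|² − θ|ω|²/(T − t)]₊ dx dt = ∞`.  PROVED (`divergentIdealExcess_holds`). -/
def DivergentIdealExcess : Prop :=
  ∀ (ν T : ℝ), 0 < ν → 0 < T → ∀ (u : ℝ → LiouvilleSocket.E3 → LiouvilleSocket.E3) (p : ℝ → LiouvilleSocket.E3 → ℝ),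
    IsMaximalSmoothSolution ν 0 u p T → IsLerayHopfOn T ν 0 (u 0) u →
    HasRapidSpatialDecay (u 0) → IsTypeIBlowup u T →
    ∀ θ : ℝ, θ < 1 → ∀ t₀ : ℝ, 0 ≤ t₀ → t₀ < T →
    ∀ Λ : ℝ → ℝ, LiouvilleSocket.IsSubcriticalLevel T Λ → Measurable Λ → ∫⁻ z, idlIntegrand T θ t₀ Λ u z = ⊤

/-- **Residual** (maximal frame): every maximal Type-I Clay blow-up has, for some `θ < 1`, some `t₀ ∈ [0,T)` and some
measurable subcritical level, an integrable material excess OR an integrable ideal excess.  DECLARED ≡ row F1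
(`tableSlack_iff_rowF1`); no movement on `Row_F1` is claimed. -/
@[conjecture] def TableSlack : Prop :=
  ∀ (ν T : ℝ), 0 < ν → 0 < T → ∀ (u : ℝ → LiouvilleSocket.E3 → LiouvilleSocket.E3) (p : ℝ → LiouvilleSocket.E3 → ℝ),
    IsMaximalSmoothSolution ν 0 u p T → IsLerayHopfOn T ν 0 (u 0) u →
    HasRapidSpatialDecay (u 0) → IsTypeIBlowup u T →
    (∃ (θ t₀ : ℝ) (Λ : ℝ → ℝ), θ < 1 ∧ 0 ≤ t₀ ∧ t₀ < T ∧ LiouvilleSocket.IsSubcriticalLevel T Λ ∧ Measurable Λ ∧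
      ∫⁻ z, matIntegrand T θ t₀ Λ u z < ⊤) ∨
    (∃ (θ t₀ : ℝ) (Λ : ℝ → ℝ), θ < 1 ∧ 0 ≤ t₀ ∧ t₀ < T ∧ LiouvilleSocket.IsSubcriticalLevel T Λ ∧ Measurable Λ ∧
      ∫⁻ z, idlIntegrand T θ t₀ Λ u z < ⊤)

/-- **The split**: the two criterion rows + the residual ⇒ row F1 (by cases on extendability and on the cell). -/
theorem rowF1_of (hM : Row_F1im) (hI : Row_F1id) (hR : TableSlack) : ScenarioCensus.Row_F1 := by
  unfold ScenarioCensus.Row_F1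
  intro ν T hν hT u p hsol hLH hdec hTI
  by_contra hext
  rcases hR ν T hν hT u p ⟨hsol, hext⟩ hLH hdec hTI with h | h
  · exact hext (hM ν T hν hT u p hsol hLH hdec hTI h)
  · exact hext (hI ν T hν hT u p hsol hLH hdec hTI h)

/-- Row F1 ⇒ the residual (vacuously: no maximal Type-I Clay blow-up). -/
theorem tableSlack_of_rowF1 (h : ScenarioCensus.Row_F1) : TableSlack :=
  fun ν T hν hT u p hmax hLH hdec hTI => (hmax.2 (h ν T hν hT u p hmax.1 hLH hdec hTI)).elim

/-! ### Dictionary: the numbers = `ν^{5/2} ×` the normalised `[t₀,T)`-top integrands of `matOf θ` / `idlOf θ`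
(kinematics + the vorticity equation `FrozenTop.freeze_eq` for the material cell; pure kinematics for the ideal cell) -/

/-- `ν Δω + (ω·∇)u = ∂ₜω + (u·∇)ω` on `[0, T)` (the vorticity equation, material form). -/
theorem material_vort_eq {ν T : ℝ} (hT : 0 < T) {u : ℝ → LiouvilleSocket.E3 → LiouvilleSocket.E3} {p : ℝ → LiouvilleSocket.E3 → ℝ}
    (hsol : IsClassicalNSSolutionOn (Ico 0 T) ν 0 u p) {t : ℝ} (ht : t ∈ Ico 0 T) (x : LiouvilleSocket.E3) :
    ν • (Δ (curl (u t))) x + convect (curl (u t)) (u t) x =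
      timeDerivWithin (Ico 0 T) (vorticity u) t x + convect (u t) (curl (u t)) x := by
  rw [← FrozenTop.freeze_eq hT hsol ht x]
  abel

/-- `LiouvilleSocket.topIntegrandτ(matOf θ) = ofReal(√ν · ν⁻³) · matIntegrand` pointwise, for classical solutions on `[0, T)`. -/
theorem topIntegrandτ_matOf_eq {ν T : ℝ} (hν : 0 < ν) (hT : 0 < T) {u : ℝ → LiouvilleSocket.E3 → LiouvilleSocket.E3} {p : ℝ → LiouvilleSocket.E3 → ℝ}
    (hsol : IsClassicalNSSolutionOn (Ico 0 T) ν 0 u p) {t₀ : ℝ} (ht₀ : 0 ≤ t₀) (θ : ℝ) (Λ : ℝ → ℝ)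
    (z : ℝ × LiouvilleSocket.E3) :
    LiouvilleSocket.topIntegrandτ T ν t₀ Λ (fun τ v L H K => matOf θ τ v L H K) u z =
      ENNReal.ofReal (Real.sqrt ν * (ν ^ 3)⁻¹) * matIntegrand T θ t₀ Λ u z := by
  by_cases hz : z ∈ {z : ℝ × LiouvilleSocket.E3 | z.1 ∈ Ico t₀ T ∧ Λ z.1 < ‖u z.1 z.2‖}
  · have hσ : 0 < T - z.1 := sub_pos.2 hz.1.2
    have hz0 : z.1 ∈ Ico 0 T := ⟨ht₀.trans hz.1.1, hz.1.2⟩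
    rw [LiouvilleSocket.topIntegrandτ, matIntegrand, indicator_of_mem hz, indicator_of_mem hz,
      ← ENNReal.ofReal_mul (mul_nonneg (Real.sqrt_nonneg ν) (inv_nonneg.2 (pow_nonneg hν.le 3)))]
    congr 1
    have h3 : ContDiff ℝ 3 (u z.1) := (hsol.contDiff_velocity hz0).of_le (by norm_cast)
    have key := nu_readout_matOf hν hσ θ h3 z.2
    rw [material_vort_eq hT hsol hz0 z.2] at key
    have hν3 : ν ^ 3 ≠ 0 := by positivity
    have hI : matOf θ (ν * (T - z.1)) (ν⁻¹ • u z.1 z.2) (ν⁻¹ • fderiv ℝ (u z.1) z.2)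
        (ν⁻¹ • fderiv ℝ (fderiv ℝ (u z.1)) z.2) (ν⁻¹ • LiouvilleSocket.lapD (u z.1) z.2) =  -- (the τ-tool's `lapD`; defeq)
        (ν ^ 3)⁻¹ * (⟪curl (u z.1) z.2,
            timeDerivWithin (Ico 0 T) (vorticity u) z.1 z.2 + convect (u z.1) (curl (u z.1)) z.2⟫
          - θ * ((T - z.1)⁻¹ * ‖curl (u z.1) z.2‖ ^ 2)) := by
      rw [eq_inv_mul_iff_mul_eq₀ hν3]
      exact key
    have hmax : ∀ P : ℝ, max 0 ((ν ^ 3)⁻¹ * P) = (ν ^ 3)⁻¹ * max 0 P := fun P => by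
      rw [mul_max_of_nonneg _ _ (inv_nonneg.2 (pow_nonneg hν.le 3)), mul_zero]
    rw [hI, Real.sqrt_mul hν.le, hmax]
    ring
  · rw [LiouvilleSocket.topIntegrandτ, matIntegrand, indicator_of_notMem hz, indicator_of_notMem hz, mul_zero]

/-- `∫ LiouvilleSocket.topIntegrandτ(matOf θ) = ν^{-5/2} ∫ matIntegrand`. -/
theorem lintegral_topIntegrandτ_matOf_eq {ν T : ℝ} (hν : 0 < ν) (hT : 0 < T) {u : ℝ → LiouvilleSocket.E3 → LiouvilleSocket.E3} {p : ℝ → LiouvilleSocket.E3 → ℝ}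
    (hsol : IsClassicalNSSolutionOn (Ico 0 T) ν 0 u p) {t₀ : ℝ} (ht₀ : 0 ≤ t₀) (θ : ℝ) (Λ : ℝ → ℝ) :
    ∫⁻ z, LiouvilleSocket.topIntegrandτ T ν t₀ Λ (fun τ v L H K => matOf θ τ v L H K) u z =
      ENNReal.ofReal (Real.sqrt ν * (ν ^ 3)⁻¹) * ∫⁻ z, matIntegrand T θ t₀ Λ u z := by
  rw [← lintegral_const_mul' _ _ ENNReal.ofReal_ne_top]
  exact lintegral_congr fun z => topIntegrandτ_matOf_eq hν hT hsol ht₀ θ Λ z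

/-- `LiouvilleSocket.topIntegrandτ(idlOf θ) = ofReal(√ν · ν⁻³) · idlIntegrand` pointwise, for classical solutions on `[0, T)` (pure
kinematics: only `C³` regularity of the slices is used). -/
theorem topIntegrandτ_idlOf_eq {ν T : ℝ} (hν : 0 < ν) {u : ℝ → LiouvilleSocket.E3 → LiouvilleSocket.E3} {p : ℝ → LiouvilleSocket.E3 → ℝ}
    (hsol : IsClassicalNSSolutionOn (Ico 0 T) ν 0 u p) {t₀ : ℝ} (ht₀ : 0 ≤ t₀) (θ : ℝ) (Λ : ℝ → ℝ)
    (z : ℝ × LiouvilleSocket.E3) :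
    LiouvilleSocket.topIntegrandτ T ν t₀ Λ (fun τ v L H K => idlOf θ τ v L H K) u z =
      ENNReal.ofReal (Real.sqrt ν * (ν ^ 3)⁻¹) * idlIntegrand T θ t₀ Λ u z := by
  by_cases hz : z ∈ {z : ℝ × LiouvilleSocket.E3 | z.1 ∈ Ico t₀ T ∧ Λ z.1 < ‖u z.1 z.2‖}
  · have hσ : 0 < T - z.1 := sub_pos.2 hz.1.2
    have hz0 : z.1 ∈ Ico 0 T := ⟨ht₀.trans hz.1.1, hz.1.2⟩
    rw [LiouvilleSocket.topIntegrandτ, idlIntegrand, indicator_of_mem hz, indicator_of_mem hz,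
      ← ENNReal.ofReal_mul (mul_nonneg (Real.sqrt_nonneg ν) (inv_nonneg.2 (pow_nonneg hν.le 3)))]
    congr 1
    have h3 : ContDiff ℝ 3 (u z.1) := (hsol.contDiff_velocity hz0).of_le (by norm_cast)
    have key := nu_readout_idlOf hν hσ θ h3 z.2
    have hν3 : ν ^ 3 ≠ 0 := by positivity
    have hI : idlOf θ (ν * (T - z.1)) (ν⁻¹ • u z.1 z.2) (ν⁻¹ • fderiv ℝ (u z.1) z.2)
        (ν⁻¹ • fderiv ℝ (fderiv ℝ (u z.1)) z.2) (ν⁻¹ • LiouvilleSocket.lapD (u z.1) z.2) =  -- (the τ-tool's `lapD`; defeq)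
        (ν ^ 3)⁻¹ * (⟪curl (u z.1) z.2, convect (curl (u z.1)) (u z.1) z.2 - convect (u z.1) (curl (u z.1)) z.2⟫
          - θ * ((T - z.1)⁻¹ * ‖curl (u z.1) z.2‖ ^ 2)) := by
      rw [eq_inv_mul_iff_mul_eq₀ hν3]
      exact key
    have hmax : ∀ P : ℝ, max 0 ((ν ^ 3)⁻¹ * P) = (ν ^ 3)⁻¹ * max 0 P := fun P => by
      rw [mul_max_of_nonneg _ _ (inv_nonneg.2 (pow_nonneg hν.le 3)), mul_zero]
    rw [hI, Real.sqrt_mul hν.le, hmax]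
    ring
  · rw [LiouvilleSocket.topIntegrandτ, idlIntegrand, indicator_of_notMem hz, indicator_of_notMem hz, mul_zero]

/-- `∫ LiouvilleSocket.topIntegrandτ(idlOf θ) = ν^{-5/2} ∫ idlIntegrand`. -/
theorem lintegral_topIntegrandτ_idlOf_eq {ν T : ℝ} (hν : 0 < ν) {u : ℝ → LiouvilleSocket.E3 → LiouvilleSocket.E3} {p : ℝ → LiouvilleSocket.E3 → ℝ}
    (hsol : IsClassicalNSSolutionOn (Ico 0 T) ν 0 u p) {t₀ : ℝ} (ht₀ : 0 ≤ t₀) (θ : ℝ) (Λ : ℝ → ℝ) :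
    ∫⁻ z, LiouvilleSocket.topIntegrandτ T ν t₀ Λ (fun τ v L H K => idlOf θ τ v L H K) u z =
      ENNReal.ofReal (Real.sqrt ν * (ν ^ 3)⁻¹) * ∫⁻ z, idlIntegrand T θ t₀ Λ u z := by
  rw [← lintegral_const_mul' _ _ ENNReal.ofReal_ne_top]
  exact lintegral_congr fun z => topIntegrandτ_idlOf_eq hν hsol ht₀ θ Λ z

/-! ### Both rows are EXCLUDED; the floors; the residual ≡ `Row_F1` -/

/-- **Criterion row F1im is EXCLUDED** (in kernel).  Engine: singular zoom at a non-extendable point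
(`FrozenTop.exists_singularZoom_package₃`) → the time-dependent INTEGRAL TRANSFER `LiouvilleSocket.integral_transfer₆τ` gives
`⟪ω̃, ∂ₛω̃ + (W·∇)ω̃⟫ − θ|ω̃|²/(−s) ≤ 0` wherever `W ≠ 0` → analytic globalisation (`FrozenTop.jointCond_everywhere₄`) → EVERYWHERE
on the open past → THE MATERIAL KILL `eq_zero_of_materialEbbing` (first-order maximum principle, `θ < 1`) → `W ≡ 0`,
contradicting non-triviality of the zoom limit. -/
theorem rowF1im_holds : Row_F1im := by
  intro ν T hν hT u p hsol hLH hdec hTI htop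
  obtain ⟨θ, t₀, Λ, hθ, ht₀, ht₀T, hΛ, hΛm, hfinP⟩ := htop
  obtain ⟨M, hM⟩ := LiouvilleSocket.exists_isTypeIBlowupWith hν hTI
  have hfin : ∫⁻ z, LiouvilleSocket.topIntegrandτ T ν t₀ Λ (fun τ v L H K => matOf θ τ v L H K) u z < ⊤ := by
    rw [lintegral_topIntegrandτ_matOf_eq hν hT hsol ht₀ θ Λ]
    exact ENNReal.mul_lt_top ENNReal.ofReal_lt_top hfinP
  apply hasSmoothExtensionPast_of_forall_exists_parabolicCylinder hν hT hsol hLH hdec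
  intro x₀
  by_contra hno
  obtain ⟨α, β, R, c, W, hα, hβ, hR, hαR, hαν, hcpos, hclim, hW, hpt, hgrad, hhess, hlap, t, ht, y, hne⟩ :=
    FrozenTop.exists_singularZoom_package₃ hν hT hsol hLH hdec hM x₀ (InviscidTop.sing_of_not_bounded hno)
  have hRd := LiouvilleSocket.integral_transfer₆τ hν hsol hW ht₀ ht₀T hα hβ hαR hαν hcpos hclim hpt hgrad hhess hlap
    (Rd := fun τ v L H K => matOf θ τ v L H K) (continuousOn_matOf θ)
    (fun a ha τ hτ v L H K => matOf_smul ha hτ θ v L H K) hΛ hΛm hfin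
  have hall := FrozenTop.jointCond_everywhere₄ hW (P := fun w q => matOf θ (-w) q.1 q.2.1 q.2.2.1 q.2.2.2 ≤ 0)
    (fun w => isClosed_le (continuous_matOf_fixed θ (-w)) continuous_const)
    (fun w => by show matOf θ (-w) 0 0 0 0 ≤ 0; rw [matOf_zero]) hRd
  refine hne (eq_zero_of_materialEbbing hθ hW (fun s hs y' => ?_) t ht y)
  have hb := hall s hs y'
  rw [matOf_slice hW θ (-s) hs y'] at hb
  linarith

/-- **Criterion row F1id is EXCLUDED** (in kernel): same engine with the read-out `idlOf θ`; the kill is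
`eq_zero_of_idealEbbing` (second-order maximum principle without drift, `θ < 1`). -/
theorem rowF1id_holds : Row_F1id := by
  intro ν T hν hT u p hsol hLH hdec hTI htop
  obtain ⟨θ, t₀, Λ, hθ, ht₀, ht₀T, hΛ, hΛm, hfinP⟩ := htop
  obtain ⟨M, hM⟩ := LiouvilleSocket.exists_isTypeIBlowupWith hν hTI
  have hfin : ∫⁻ z, LiouvilleSocket.topIntegrandτ T ν t₀ Λ (fun τ v L H K => idlOf θ τ v L H K) u z < ⊤ := by
    rw [lintegral_topIntegrandτ_idlOf_eq hν hsol ht₀ θ Λ]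
    exact ENNReal.mul_lt_top ENNReal.ofReal_lt_top hfinP
  apply hasSmoothExtensionPast_of_forall_exists_parabolicCylinder hν hT hsol hLH hdec
  intro x₀
  by_contra hno
  obtain ⟨α, β, R, c, W, hα, hβ, hR, hαR, hαν, hcpos, hclim, hW, hpt, hgrad, hhess, hlap, t, ht, y, hne⟩ :=
    FrozenTop.exists_singularZoom_package₃ hν hT hsol hLH hdec hM x₀ (InviscidTop.sing_of_not_bounded hno)
  have hRd := LiouvilleSocket.integral_transfer₆τ hν hsol hW ht₀ ht₀T hα hβ hαR hαν hcpos hclim hpt hgrad hhess hlap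
    (Rd := fun τ v L H K => idlOf θ τ v L H K) (continuousOn_idlOf θ)
    (fun a ha τ hτ v L H K => idlOf_smul ha hτ θ v L H K) hΛ hΛm hfin
  have hall := FrozenTop.jointCond_everywhere₄ hW (P := fun w q => idlOf θ (-w) q.1 q.2.1 q.2.2.1 q.2.2.2 ≤ 0)
    (fun w => isClosed_le (continuous_idlOf_fixed θ (-w)) continuous_const)
    (fun w => by show idlOf θ (-w) 0 0 0 0 ≤ 0; rw [idlOf_zero]) hRd
  refine hne (eq_zero_of_idealEbbing hθ hW (fun s hs y' => ?_) t ht y)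
  have hb := hall s hs y'
  rw [idlOf_slice hW θ (-s) hs y'] at hb
  linarith

/-- **The floor DIVERGENT MATERIAL EXCESS holds.** -/
theorem divergentMaterialExcess_holds : DivergentMaterialExcess := by
  intro ν T hν hT u p hmax hLH hdec hTI θ hθ t₀ ht₀ ht₀T Λ hΛ hΛm
  by_contra hne
  exact hmax.2 (rowF1im_holds ν T hν hT u p hmax.1 hLH hdec hTI
    ⟨θ, t₀, Λ, hθ, ht₀, ht₀T, hΛ, hΛm, lt_top_iff_ne_top.2 hne⟩)

/-- **The floor DIVERGENT IDEAL EXCESS holds.** -/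
theorem divergentIdealExcess_holds : DivergentIdealExcess := by
  intro ν T hν hT u p hmax hLH hdec hTI θ hθ t₀ ht₀ ht₀T Λ hΛ hΛm
  by_contra hne
  exact hmax.2 (rowF1id_holds ν T hν hT u p hmax.1 hLH hdec hTI
    ⟨θ, t₀, Λ, hθ, ht₀, ht₀T, hΛ, hΛm, lt_top_iff_ne_top.2 hne⟩)

/-- **THE TWO NEW FLOORS OF THE RATE TABLE** (structural theorem, maximal frame): for a maximal Type-I Clay blow-up,
on the fast set of EVERY measurable subcritical speed level and on every `[t₀, T)`, BOTH the material rate `½Dₜ|ω|²`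
AND the ideal rate `⟪ω, Sω⟫ − ½(u·∇)|ω|²` of the enstrophy density exceed every fraction `θ < 1` of the self-similar
rate `|ω|²/(T − t)` NON-INTEGRABLY against `√(T − t)`.  PROVED. -/
theorem rateTableFloors_holds : DivergentMaterialExcess ∧ DivergentIdealExcess :=
  ⟨divergentMaterialExcess_holds, divergentIdealExcess_holds⟩

/-- The residual is EXACTLY row F1 (declared; no movement on `Row_F1` is claimed). -/
theorem tableSlack_iff_rowF1 : TableSlack ↔ ScenarioCensus.Row_F1 :=
  ⟨rowF1_of rowF1im_holds rowF1id_holds, tableSlack_of_rowF1⟩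

/-- Row F1 from the residual alone (both criterion rows being proved). -/
theorem rowF1_of_tableSlack (h : TableSlack) : ScenarioCensus.Row_F1 :=
  rowF1_of rowF1im_holds rowF1id_holds h

/-! ### Ancient displays of the two kills -/

/-- **MATERIALLY θ-EBBING TYPE-I ANCIENT SOLUTIONS ARE TRIVIAL** (`θ < 1`; `∂ₛω̃` written out, so the hypothesis reads
`⟪ω̃, Δω̃ + (ω̃·∇)W⟫ ≤ θ|ω̃|²/(−s)`: stretching net of diffusive quenching never exceeds the fraction `θ` of the
self-similar rate). -/
theorem materialEbbing_ancient_trivial {C θ : ℝ} (hθ : θ < 1) {W : ℝ → LiouvilleSocket.E3 → LiouvilleSocket.E3} (hW : IsTypeIAncientMild C W)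
    (h : ∀ s < (0 : ℝ), ∀ y : LiouvilleSocket.E3,
      ⟪curl (W s) y, (Δ (curl (W s))) y + convect (curl (W s)) (W s) y⟫ ≤ θ * ((-s)⁻¹ * ‖curl (W s) y‖ ^ 2)) :
    ∀ s < (0 : ℝ), ∀ y : LiouvilleSocket.E3, W s y = 0 := by
  refine eq_zero_of_materialEbbing hθ hW fun s hs y => ?_
  have e : IntegratedQuench.vdot W s y + fderiv ℝ (curl (W s)) y (W s y) = (Δ (curl (W s))) y + convect (curl (W s)) (W s) y := by
    rw [IntegratedQuench.vdot, ← convect_apply (W s) (curl (W s)) y]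
    abel
  rw [e]
  exact h s hs y

-- `materialNonIncreasing_ancient_trivial`: the line restates the tree's `IntegratedQuench.eq_zero_of_nonIntensifying`; taken BY NAME (gate lint dedup.landed).

/-- **IDEALLY θ-EBBING TYPE-I ANCIENT SOLUTIONS ARE TRIVIAL** (`θ < 1`; `∂ₛω̃ − Δω̃` written out: the hypothesis reads
`⟪ω̃, (ω̃·∇)W − (W·∇)ω̃⟫ ≤ θ|ω̃|²/(−s)` — stretching net of the advective flux of enstrophy). -/
theorem idealEbbing_ancient_trivial {C θ : ℝ} (hθ : θ < 1) {W : ℝ → LiouvilleSocket.E3 → LiouvilleSocket.E3} (hW : IsTypeIAncientMild C W)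
    (h : ∀ s < (0 : ℝ), ∀ y : LiouvilleSocket.E3,
      ⟪curl (W s) y, convect (curl (W s)) (W s) y - convect (W s) (curl (W s)) y⟫ ≤
        θ * ((-s)⁻¹ * ‖curl (W s) y‖ ^ 2)) :
    ∀ s < (0 : ℝ), ∀ y : LiouvilleSocket.E3, W s y = 0 := by
  refine eq_zero_of_idealEbbing hθ hW fun s hs y => ?_
  have e : IntegratedQuench.vdot W s y - (Δ (curl (W s))) y = convect (curl (W s)) (W s) y - convect (W s) (curl (W s)) y := by
    rw [IntegratedQuench.vdot]
    abel
  rw [e]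
  exact h s hs y

/-- The sign case `θ = 0` of the ideal kill: a `𝒦` in which vortex stretching never exceeds the advective influx of
enstrophy, `⟪ω̃, (ω̃·∇)W⟫ ≤ ⟪ω̃, (W·∇)ω̃⟫` at every point, is trivial. -/
theorem idealNonIncreasing_ancient_trivial {C : ℝ} {W : ℝ → LiouvilleSocket.E3 → LiouvilleSocket.E3} (hW : IsTypeIAncientMild C W)
    (h : ∀ s < (0 : ℝ), ∀ y : LiouvilleSocket.E3, ⟪curl (W s) y, convect (curl (W s)) (W s) y⟫ ≤ ⟪curl (W s) y, convect (W s) (curl (W s)) y⟫) :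
    ∀ s < (0 : ℝ), ∀ y : LiouvilleSocket.E3, W s y = 0 :=
  idealEbbing_ancient_trivial zero_lt_one hW fun s hs y => by
    rw [zero_mul, inner_sub_right, sub_nonpos]
    exact h s hs y

end Summit.NavierStokesRegularity.NavierStokesRegularity.Theorems.ScenarioCensus.RateTable

end
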